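import Summits.QuantumAdvantage.QuantumAdvantage.Theorems.LinnikCubicClassGroupsPureCubicClassGroupFBQPStubCubicGiantStepCycleChain
import Literature.NumberTheory.CubicFields.PureCubicLabelBounds

/-!
# Crux `LinnikCubicClassGroups.PureCubicClassGroupFBQP` (stmt-QuantumAdvantage-11544) — stub `stub_cubicGiantStepCycle`, part Loops

Line `arakelov-giant-step-cycle`, stub `stub_cubicGiantStepCycle` (S3b-W1), THIRD PART: THE THREE FLAGGED LOOPS OF
THE CUBIC WALK on Voronoi's chain `ν = voronoiChain σ₁ σ₂ 𝓞_K 1` (`J i = ν(i)⁻¹𝓞_K`, `ℓ i = log σ₁ ν(i)`, codes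
`cd i` of the `J i` from part Chain, `s` the increasing enumeration of the big-gap indices):

* `unitS_chain` — `unitS` (≤ 6 flagged steps from `ordL`) is `(cd (s 0), ≈ 2^prec ℓ(s 0))` (error `≤ 5`);
* `rhoS_chain` — the filtered baby step: `rhoS (cd (s i)) = (cd (s (i+1)), ≈ 2^prec (ℓ(s(i+1)) − ℓ(s i)))`
  (error `≤ 6`);
* `latProd_chain` — the product code of `cd (s i₁)`, `cd (s i₂)` codes `(ν(s i₁)ν(s i₂))⁻¹𝓞_K`;
* `starS_chain` — the filtered giant step: the first reduction of the product lands on the chain at some `J k`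
  (`exists_eq_inv_mul_voronoiChain`) with certified log `≈ 2^prec (ℓ k − ℓ(s i₁) − ℓ(s i₂))` and
  `−log|d_K| ≤ ℓ k − ℓ(s i₁) − ℓ(s i₂) ≤ log(3√|d_K|)` (`log_cylinderMin_bounds`), then `≤ 5` flagged steps reach
  `cd (s i)`, `0 ≤ ℓ(s i) − ℓ k ≤ 5 log(3√|d_K|)`; total evaluator error `≤ 6`;
* `chainLabel_bounds` — the canonical code of a reduced ideal `ν(i)⁻¹𝓞_K` has denominator and entries
  `≤ 243a²b²` (`PureCubicLabelBounds`);
* `cubicWalk_facts` — closed form of the three (the sub-goal registered for this file): the walk facts consumed by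
  `GiantStepCycle.exists_of_chain`, with the raw defect evaluator `starS.2 + unitS.2` within `16` of `2^prec ×` the
  true defect `ℓ(s i) − ℓ(s i₁) − ℓ(s i₂) + ℓ(s 0)` and `|defect| ≤ 11 log(3√|d_K|)`.
-/

-- the problem namespace repeats the summit name (`QuantumAdvantage.QuantumAdvantage`)
set_option linter.dupNamespace false

namespace Summit.QuantumAdvantage.QuantumAdvantage.Theorems.LinnikCubicClassGroups

open scoped NumberField nonZeroDivisors
open NumberField
open Literature.Computability.Cryptography
open Literature.Computability.Cryptography.CubicClassTable
open Literature.NumberTheory.CubicFields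
open Literature.NumberTheory.CubicFields.PureCubicCodes (Mem Canon val canon_unique den_dvd_three_mul_natAbs_norm
  entries_le_den)
open Literature.NumberTheory.NumberFields.PureCubic

section Loops

variable {K : Type} [Field K] [NumberField K] (hdeg : Module.finrank ℚ K = 3)
  {σ₁ : K →+* ℝ} {σ₂ : K →+* ℂ} (hσ₂ : ∃ z : K, starRingEnd ℂ (σ₂ z) ≠ σ₂ z)
  (ε : (𝓞 K)ˣ) (hε : 1 < σ₁ (algebraMap (𝓞 K) K ε))
  {a b : ℕ} (hab : Squarefree (a * b)) (hab1 : a * b ≠ 1) {θ : K} (hθ : θ ^ 3 = ((a * b ^ 2 : ℕ) : K))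
  {lexE : (ℕ × ℕ) × (ℕ × List ℤ) → ℤ × ℤ × ℤ × ℕ}
  {logE : (ℕ × ℕ) × ((ℤ × ℤ × ℤ × ℕ) × ℕ) → ℤ}
  {invE : (ℕ × ℕ) × (ℤ × ℤ × ℤ × ℕ) → ℤ × ℤ × ℤ × ℕ}
  {latScale : (ℕ × ℕ) × ((ℕ × List ℤ) × (ℤ × ℤ × ℤ × ℕ)) → ℕ × List ℤ}
  {latProd : (ℕ × ℕ) × ((ℕ × List ℤ) × (ℕ × List ℤ)) → ℕ × List ℤ}
  {redL : ((ℕ × ℕ) × ℕ) × (ℕ × List ℤ) → (ℕ × List ℤ) × ℤ}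
  {isBigL : (ℕ × ℕ) × (ℕ × List ℤ) → Bool}
  {ordL : ℕ × ℕ → ℕ × List ℤ}
  {rhoS : ((ℕ × ℕ) × ℕ) × (ℕ × List ℤ) → (ℕ × List ℤ) × ℤ}
  {starS : ((ℕ × ℕ) × ℕ) × ((ℕ × List ℤ) × (ℕ × List ℤ)) → (ℕ × List ℤ) × ℤ}
  {unitS : (ℕ × ℕ) × ℕ → (ℕ × List ℤ) × ℤ}
  (hlex : LexMinSpec a b K θ σ₁ σ₂ lexE) (hlog : LogSpec a b logE) (hinv : InvSpec a b K θ invE)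
  (hscale : ScaleSpec a b K θ latScale) (hred : RedLEq a b K θ lexE logE invE latScale redL)
  (hbig : IsBigEq a b K θ lexE isBigL)
  (cd : ℤ → ℕ × List ℤ)
  (hcd : ∀ i, Canon (cd i) ∧ ∀ φ : K, Mem θ b (cd i) φ ↔
    φ ∈ FractionalIdeal.spanSingleton (𝓞 K)⁰ (voronoiChain σ₁ σ₂ (1 : FractionalIdeal (𝓞 K)⁰ K) (1 : K) i)⁻¹ *
      (1 : FractionalIdeal (𝓞 K)⁰ K))
  (prec : ℕ) {s : ℤ → ℤ} (hsm : StrictMono s)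
  (hbigS : ∀ i, 11 * σ₁ (voronoiChain σ₁ σ₂ (1 : FractionalIdeal (𝓞 K)⁰ K) (1 : K) (s i)) ≤
    10 * σ₁ (voronoiChain σ₁ σ₂ (1 : FractionalIdeal (𝓞 K)⁰ K) (1 : K) (s i + 1)))
  (hsurj : ∀ j, 11 * σ₁ (voronoiChain σ₁ σ₂ (1 : FractionalIdeal (𝓞 K)⁰ K) (1 : K) j) ≤
    10 * σ₁ (voronoiChain σ₁ σ₂ (1 : FractionalIdeal (𝓞 K)⁰ K) (1 : K) (j + 1)) → ∃ i, s i = j)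
  (h6 : ∀ i, s (i + 1) ≤ s i + 6)


include hdeg hσ₂ ε hε hab hab1 hθ hlex hlog hinv hscale hred hbig hcd hsm hbigS h6 in
/-- **The unit label.** Under `UnitSEq` and `OrdSpec`: if `s 0` is the least nonnegative big-gap index then
`unitS ((a,b),prec) = (cd (s 0), acc)` with `|acc − 2^prec ℓ(s 0)| ≤ 5` (`s 0 ≤ 5` flagged steps from the code
`ordL = cd 0` of `𝓞_K`; `ℓ 0 = 0`). -/
theorem unitS_chain (hord : OrdSpec a b K θ ordL) (hunit : UnitSEq redL isBigL ordL unitS) (hs0 : 0 ≤ s 0)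
    (hs0min : ∀ j, 0 ≤ j → 11 * σ₁ (voronoiChain σ₁ σ₂ (1 : FractionalIdeal (𝓞 K)⁰ K) (1 : K) j) ≤ 10 * σ₁ (voronoiChain σ₁ σ₂ (1 : FractionalIdeal (𝓞 K)⁰ K) (1 : K) (j + 1)) → s 0 ≤ j) :
    (unitS ((a, b), prec)).1 = cd (s 0) ∧
      |((unitS ((a, b), prec)).2 : ℝ) - 2 ^ prec * Real.log (σ₁ (voronoiChain σ₁ σ₂ (1 : FractionalIdeal (𝓞 K)⁰ K) (1 : K) (s 0)))| ≤ 5 := by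
  obtain ⟨hk5, hno, hyes, hk⟩ := sZero_window hsm (fun j => 11 * σ₁ (voronoiChain σ₁ σ₂ (1 : FractionalIdeal (𝓞 K)⁰ K) (1 : K) j) ≤ 10 * σ₁ (voronoiChain σ₁ σ₂ (1 : FractionalIdeal (𝓞 K)⁰ K) (1 : K) (j + 1))) hbigS h6 hs0
    hs0min
  have hord0 : ordL (a, b) = cd 0 :=
    chainCode_unique hdeg hab hab1 hθ (ordL_codes_zero σ₁ σ₂ hord).1 (hcd 0).1 (ordL_codes_zero σ₁ σ₂ hord).2 (hcd 0).2
  have hloop := flagLoop_chain hdeg hσ₂ ε hε hab hab1 hθ hlex hlog hinv hscale hred hbig cd hcd prec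
    (hkN := hk5.trans (by norm_num : 5 ≤ 6)) 0 0 hno hyes
  obtain ⟨h1, h2⟩ := iterate_chain_step hdeg hσ₂ ε hε hab hab1 hθ hlex hlog hinv hscale hred hbig cd hcd prec
    (s 0).toNat 0 0
  rw [hk] at h1 h2
  rw [hunit, hord0, hloop]
  dsimp only
  refine ⟨h1, ?_⟩
  rw [voronoiChain_zero, map_one, Real.log_one, sub_zero, Int.cast_zero, sub_zero] at h2
  exact h2.trans (by exact_mod_cast hk5)

include hdeg hσ₂ ε hε hab hab1 hθ hlex hlog hinv hscale hred hbig hcd hsm hbigS hsurj h6 in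
/-- **The filtered baby step.** Under `RhoSEq`: `rhoS (cd (s i)) = (cd (s (i+1)), acc)` with
`|acc − 2^prec (ℓ(s(i+1)) − ℓ(s i))| ≤ 6` (one forced step to `J (s i + 1)`, then `≤ 5` flagged steps to the next
big gap `s (i+1)`). -/
theorem rhoS_chain (hrho : RhoSEq redL isBigL rhoS) (i : ℤ) :
    (rhoS (((a, b), prec), cd (s i))).1 = cd (s (i + 1)) ∧
      |((rhoS (((a, b), prec), cd (s i))).2 : ℝ) -
        2 ^ prec * (Real.log (σ₁ (voronoiChain σ₁ σ₂ (1 : FractionalIdeal (𝓞 K)⁰ K) (1 : K) (s (i + 1)))) - Real.log (σ₁ (voronoiChain σ₁ σ₂ (1 : FractionalIdeal (𝓞 K)⁰ K) (1 : K) (s i))))| ≤ 6 := by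
  -- the forced first step
  obtain ⟨-, ⟨hcan, hmem⟩, hlog1, -⟩ := chain_step hdeg hσ₂ ε hε hab hθ hlex hlog hinv hscale hred hbig prec (s i)
    (hcd (s i)).1 (hcd (s i)).2
  have e1 : (redL (((a, b), prec), cd (s i))).1 = cd (s i + 1) :=
    chainCode_unique hdeg hab hab1 hθ hcan (hcd (s i + 1)).1 hmem (hcd (s i + 1)).2
  have h7 : (fun x : ((ℕ × List ℤ) × ℤ) × Bool => if x.2 = true then x else (((redL (((a, b), prec), x.1.1)).1, x.1.2 + (redL (((a, b), prec), x.1.1)).2), isBigL ((a, b), (redL (((a, b), prec), x.1.1)).1)))^[7] ((cd (s i), 0), false) =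
      (fun x : ((ℕ × List ℤ) × ℤ) × Bool => if x.2 = true then x else (((redL (((a, b), prec), x.1.1)).1, x.1.2 + (redL (((a, b), prec), x.1.1)).2), isBigL ((a, b), (redL (((a, b), prec), x.1.1)).1)))^[6] ((((redL (((a, b), prec), cd (s i))).1, 0 + (redL (((a, b), prec), cd (s i))).2)),
        isBigL ((a, b), (redL (((a, b), prec), cd (s i))).1)) := rfl
  -- the window `s i + 1 ≤ … ≤ s (i + 1)`
  have hlt : s (i + 1 - 1) < s i + 1 := by rw [add_sub_cancel_right]; exact lt_add_one _
  have hle : s i + 1 ≤ s (i + 1) := hsm (lt_add_one i)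
  obtain ⟨hk5, hno, hyes, hk⟩ := sIndex_window hsm (fun j => 11 * σ₁ (voronoiChain σ₁ σ₂ (1 : FractionalIdeal (𝓞 K)⁰ K) (1 : K) j) ≤ 10 * σ₁ (voronoiChain σ₁ σ₂ (1 : FractionalIdeal (𝓞 K)⁰ K) (1 : K) (j + 1))) hbigS hsurj
    h6 hlt hle
  have hloop := flagLoop_chain hdeg hσ₂ ε hε hab hab1 hθ hlex hlog hinv hscale hred hbig cd hcd prec
    (hkN := hk5.trans (by norm_num : 5 ≤ 6)) (s i + 1) (0 + (redL (((a, b), prec), cd (s i))).2) hno hyes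
  obtain ⟨h1, h2⟩ := iterate_chain_step hdeg hσ₂ ε hε hab hab1 hθ hlex hlog hinv hscale hred hbig cd hcd prec
    (s (i + 1) - (s i + 1)).toNat (s i + 1) (0 + (redL (((a, b), prec), cd (s i))).2)
  rw [hk] at h1 h2
  rw [hrho, h7, e1, hloop]
  dsimp only
  refine ⟨h1, ?_⟩
  set acc := (((fun x : (ℕ × List ℤ) × ℤ => ((redL (((a, b), prec), x.1)).1, x.2 + (redL (((a, b), prec), x.1)).2))^[(s (i + 1) - (s i + 1)).toNat] (cd (s i + 1), 0 + (redL (((a, b), prec), cd (s i))).2)).2 : ℤ)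
  have e : (acc : ℝ) - 2 ^ prec * (Real.log (σ₁ (voronoiChain σ₁ σ₂ (1 : FractionalIdeal (𝓞 K)⁰ K) (1 : K) (s (i + 1)))) - Real.log (σ₁ (voronoiChain σ₁ σ₂ (1 : FractionalIdeal (𝓞 K)⁰ K) (1 : K) (s i)))) =
      ((acc : ℝ) - (((0 + (redL (((a, b), prec), cd (s i))).2 : ℤ)) : ℝ) -
        2 ^ prec * (Real.log (σ₁ (voronoiChain σ₁ σ₂ (1 : FractionalIdeal (𝓞 K)⁰ K) (1 : K) (s (i + 1)))) - Real.log (σ₁ (voronoiChain σ₁ σ₂ (1 : FractionalIdeal (𝓞 K)⁰ K) (1 : K) (s i + 1))))) +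
      (((redL (((a, b), prec), cd (s i))).2 : ℝ) -
        2 ^ prec * (Real.log (σ₁ (voronoiChain σ₁ σ₂ (1 : FractionalIdeal (𝓞 K)⁰ K) (1 : K) (s i + 1))) - Real.log (σ₁ (voronoiChain σ₁ σ₂ (1 : FractionalIdeal (𝓞 K)⁰ K) (1 : K) (s i))))) := by
    push_cast; ring
  rw [e]
  have hk5' : (((s (i + 1) - (s i + 1)).toNat : ℕ) : ℝ) ≤ 5 := by exact_mod_cast hk5
  exact (abs_add_le _ _).trans (by linarith [h2, hlog1])

include hcd in
/-- **The product of two labels.** Under `ProdSpec`, `latProd (cd (s i₁)) (cd (s i₂))` is a canonical code of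
`J (s i₁) · J (s i₂) = (ν(s i₁) ν(s i₂))⁻¹ 𝓞_K` (`mem_mul_iff_mem_closure`). -/
theorem latProd_chain (hprod : ProdSpec a b K θ latProd) (i₁ i₂ : ℤ) :
    Canon (latProd ((a, b), (cd (s i₁), cd (s i₂)))) ∧
      ∀ φ : K, Mem θ b (latProd ((a, b), (cd (s i₁), cd (s i₂)))) φ ↔
        φ ∈ FractionalIdeal.spanSingleton (𝓞 K)⁰ (voronoiChain σ₁ σ₂ (1 : FractionalIdeal (𝓞 K)⁰ K) (1 : K) (s i₁) * voronoiChain σ₁ σ₂ (1 : FractionalIdeal (𝓞 K)⁰ K) (1 : K) (s i₂))⁻¹ * (1 : FractionalIdeal (𝓞 K)⁰ K) := by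
  obtain ⟨hcan, hmem⟩ := hprod (cd (s i₁)) (cd (s i₂)) (hcd (s i₁)).1 (hcd (s i₂)).1
  refine ⟨hcan, fun φ => ?_⟩
  have e : (FractionalIdeal.spanSingleton (𝓞 K)⁰ (voronoiChain σ₁ σ₂ (1 : FractionalIdeal (𝓞 K)⁰ K) (1 : K) (s i₁))⁻¹ * (1 : FractionalIdeal (𝓞 K)⁰ K)) * (FractionalIdeal.spanSingleton (𝓞 K)⁰ (voronoiChain σ₁ σ₂ (1 : FractionalIdeal (𝓞 K)⁰ K) (1 : K) (s i₂))⁻¹ * (1 : FractionalIdeal (𝓞 K)⁰ K)) =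
      FractionalIdeal.spanSingleton (𝓞 K)⁰ (voronoiChain σ₁ σ₂ (1 : FractionalIdeal (𝓞 K)⁰ K) (1 : K) (s i₁) * voronoiChain σ₁ σ₂ (1 : FractionalIdeal (𝓞 K)⁰ K) (1 : K) (s i₂))⁻¹ * (1 : FractionalIdeal (𝓞 K)⁰ K) := by
    rw [spanSingleton_inv_mul_mul_spanSingleton_inv_mul, mul_one]
  rw [hmem φ, ← e, mem_mul_iff_mem_closure]
  simp only [(hcd (s i₁)).2, (hcd (s i₂)).2]

include hdeg hσ₂ ε hε hab hab1 hθ hlex hlog hinv hscale hred hbig hcd hsm hbigS hsurj h6 in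
/-- **The filtered giant step.** Under `StarSEq`, `ProdSpec` and `|d_K| ≤ 2^prec`: for all `i₁ i₂` there are `i`
and `k ≤ s i ≤ k + 5` with `starS (cd (s i₁), cd (s i₂)) = (cd (s i), acc)`,
`|acc − 2^prec (ℓ(s i) − ℓ(s i₁) − ℓ(s i₂))| ≤ 6`, `−log|d_K| ≤ ℓ k − ℓ(s i₁) − ℓ(s i₂) ≤ log (3√|d_K|)` and
`0 ≤ ℓ(s i) − ℓ k ≤ 5 log (3√|d_K|)`. -/
theorem starS_chain (hprod : ProdSpec a b K θ latProd) (hstar : StarSEq redL isBigL latProd starS)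
    {n₀ nS : ℕ} (hn₀ : 0 < n₀) (hsper : ∀ i, s (i + nS) = s i + n₀)
    (hdp : |(discr K : ℝ)| ≤ 2 ^ prec) (i₁ i₂ : ℤ) :
    ∃ i k : ℤ, (starS (((a, b), prec), (cd (s i₁), cd (s i₂)))).1 = cd (s i) ∧
      |((starS (((a, b), prec), (cd (s i₁), cd (s i₂)))).2 : ℝ) -
        2 ^ prec * (Real.log (σ₁ (voronoiChain σ₁ σ₂ (1 : FractionalIdeal (𝓞 K)⁰ K) (1 : K) (s i))) - Real.log (σ₁ (voronoiChain σ₁ σ₂ (1 : FractionalIdeal (𝓞 K)⁰ K) (1 : K) (s i₁))) - Real.log (σ₁ (voronoiChain σ₁ σ₂ (1 : FractionalIdeal (𝓞 K)⁰ K) (1 : K) (s i₂))))| ≤ 6 ∧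
      -Real.log |(discr K : ℝ)| ≤ Real.log (σ₁ (voronoiChain σ₁ σ₂ (1 : FractionalIdeal (𝓞 K)⁰ K) (1 : K) k)) - Real.log (σ₁ (voronoiChain σ₁ σ₂ (1 : FractionalIdeal (𝓞 K)⁰ K) (1 : K) (s i₁))) - Real.log (σ₁ (voronoiChain σ₁ σ₂ (1 : FractionalIdeal (𝓞 K)⁰ K) (1 : K) (s i₂))) ∧
      Real.log (σ₁ (voronoiChain σ₁ σ₂ (1 : FractionalIdeal (𝓞 K)⁰ K) (1 : K) k)) - Real.log (σ₁ (voronoiChain σ₁ σ₂ (1 : FractionalIdeal (𝓞 K)⁰ K) (1 : K) (s i₁))) - Real.log (σ₁ (voronoiChain σ₁ σ₂ (1 : FractionalIdeal (𝓞 K)⁰ K) (1 : K) (s i₂))) ≤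
        Real.log (3 * Real.sqrt |(discr K : ℝ)|) ∧
      0 ≤ Real.log (σ₁ (voronoiChain σ₁ σ₂ (1 : FractionalIdeal (𝓞 K)⁰ K) (1 : K) (s i))) - Real.log (σ₁ (voronoiChain σ₁ σ₂ (1 : FractionalIdeal (𝓞 K)⁰ K) (1 : K) k)) ∧
      Real.log (σ₁ (voronoiChain σ₁ σ₂ (1 : FractionalIdeal (𝓞 K)⁰ K) (1 : K) (s i))) - Real.log (σ₁ (voronoiChain σ₁ σ₂ (1 : FractionalIdeal (𝓞 K)⁰ K) (1 : K) k)) ≤ 5 * Real.log (3 * Real.sqrt |(discr K : ℝ)|) := by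
  have hone := one_mem_posRelMinima_one (σ₁ := σ₁) hdeg hσ₂
  obtain ⟨hν₁, hp₁, h0₁, -⟩ := voronoiChain_one_facts hdeg hσ₂ ε hε (s i₁)
  obtain ⟨hν₂, hp₂, h0₂, -⟩ := voronoiChain_one_facts hdeg hσ₂ ε hε (s i₂)
  set c : K := voronoiChain σ₁ σ₂ (1 : FractionalIdeal (𝓞 K)⁰ K) (1 : K) (s i₁) * voronoiChain σ₁ σ₂ (1 : FractionalIdeal (𝓞 K)⁰ K) (1 : K) (s i₂) with hc
  have hcpos : 0 < σ₁ c := by rw [hc, map_mul]; exact mul_pos hp₁ hp₂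
  have hc0 : c ≠ 0 := mul_ne_zero h0₁ h0₂
  set M : FractionalIdeal (𝓞 K)⁰ K := FractionalIdeal.spanSingleton (𝓞 K)⁰ c⁻¹ * 1 with hM
  have hM0 : M ≠ 0 := by
    rw [hM, mul_one]; exact FractionalIdeal.spanSingleton_ne_zero_iff.mpr (inv_ne_zero hc0)
  have hMJ : (FractionalIdeal.spanSingleton (𝓞 K)⁰ (voronoiChain σ₁ σ₂ (1 : FractionalIdeal (𝓞 K)⁰ K) (1 : K) (s i₁))⁻¹ * (1 : FractionalIdeal (𝓞 K)⁰ K)) * (FractionalIdeal.spanSingleton (𝓞 K)⁰ (voronoiChain σ₁ σ₂ (1 : FractionalIdeal (𝓞 K)⁰ K) (1 : K) (s i₂))⁻¹ * (1 : FractionalIdeal (𝓞 K)⁰ K)) = M := by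
    rw [hM, spanSingleton_inv_mul_mul_spanSingleton_inv_mul, mul_one]
  -- the product code and its first reduction
  obtain ⟨hcanP, hmemP⟩ := latProd_chain cd hcd (s := s) hprod i₁ i₂
  obtain ⟨hden, hmem, hpos, hcyl, hmin⟩ := hlex _ hcanP ⟨M, hM0, hmemP⟩
  set γ : K := val θ b (lexE ((a, b), latProd ((a, b), (cd (s i₁), cd (s i₂))))) with hγ
  obtain ⟨hγrel, hlo, hhi⟩ := cylinder_least_bounds hdeg hσ₂ hM0 ((hmemP γ).1 hmem) hpos hcyl
    (fun φ hφ => hmin φ ((hmemP φ).2 hφ))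
  obtain ⟨k, hk⟩ := exists_eq_inv_mul_voronoiChain hdeg hσ₂ ε hε hone hcpos hγrel
  obtain ⟨hνk, hpk, h0k, -⟩ := voronoiChain_one_facts hdeg hσ₂ ε hε k
  obtain ⟨hcanR, -, hmemR⟩ := redL_fst_spec hlex hinv hscale hred prec hcanP hM0 hmemP
  have eR : (redL (((a, b), prec), latProd ((a, b), (cd (s i₁), cd (s i₂))))).1 = cd k := by
    refine chainCode_unique hdeg hab hab1 hθ hcanR (hcd k).1 (fun φ => ?_) (hcd k).2
    rw [hmemR φ, ← hγ, hk, hM, spanSingleton_inv_mul_inv_mul hc0]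
  -- norm and log bounds of the reducing element
  obtain ⟨hN, hN1⟩ := absNorm_mul_reduced_bounds hdeg hσ₂ (one_mem_posRelMinima_inv_mul hν₁)
    (one_mem_posRelMinima_inv_mul hν₂)
  rw [hMJ] at hN hN1
  obtain ⟨hlog_lo, hlog_hi, hinvd⟩ := log_cylinderMin_bounds hdeg hσ₂ hN hN1 hlo hhi
  have hd : 0 < |(discr K : ℝ)| := by rw [← Int.cast_abs]; exact_mod_cast abs_pos.mpr (discr_ne_zero K)
  have hp : (1 : ℝ) / 2 ^ prec ≤ σ₁ γ :=
    le_trans (one_div_le_one_div_of_le hd hdp) hinvd.le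
  have hlogR := redL_snd_spec hab hθ hlex hlog hred prec hcanP hM0 hmemP hp
  rw [← hγ] at hlogR
  have hlogγ : Real.log (σ₁ γ) = Real.log (σ₁ (voronoiChain σ₁ σ₂ (1 : FractionalIdeal (𝓞 K)⁰ K) (1 : K) k)) - Real.log (σ₁ (voronoiChain σ₁ σ₂ (1 : FractionalIdeal (𝓞 K)⁰ K) (1 : K) (s i₁))) - Real.log (σ₁ (voronoiChain σ₁ σ₂ (1 : FractionalIdeal (𝓞 K)⁰ K) (1 : K) (s i₂))) := by
    rw [hk, map_mul, map_inv₀, hc, map_mul, Real.log_mul (inv_ne_zero (mul_pos hp₁ hp₂).ne') hpk.ne',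
      Real.log_inv, Real.log_mul hp₁.ne' hp₂.ne']
    ring
  -- the window after `k`
  obtain ⟨i, hlt, hle⟩ := exists_sIndex hsm hn₀ hsper k
  obtain ⟨hm5, hno, hyes, hm⟩ := sIndex_window hsm (fun j => 11 * σ₁ (voronoiChain σ₁ σ₂ (1 : FractionalIdeal (𝓞 K)⁰ K) (1 : K) j) ≤ 10 * σ₁ (voronoiChain σ₁ σ₂ (1 : FractionalIdeal (𝓞 K)⁰ K) (1 : K) (j + 1))) hbigS hsurj
    h6 hlt hle
  have hloop := flagLoop_chain hdeg hσ₂ ε hε hab hab1 hθ hlex hlog hinv hscale hred hbig cd hcd prec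
    (hkN := hm5.trans (by norm_num : 5 ≤ 6)) k (redL (((a, b), prec), latProd ((a, b), (cd (s i₁), cd (s i₂))))).2
    hno hyes
  obtain ⟨h1, h2⟩ := iterate_chain_step hdeg hσ₂ ε hε hab hab1 hθ hlex hlog hinv hscale hred hbig cd hcd prec
    (s i - k).toNat k (redL (((a, b), prec), latProd ((a, b), (cd (s i₁), cd (s i₂))))).2
  rw [hm] at h1 h2
  refine ⟨i, k, ?_, ?_, hlogγ ▸ hlog_lo, hlogγ ▸ hlog_hi,
    sub_nonneg.mpr (log_voronoiChain_le_of_le hdeg hσ₂ ε hε hone hle), ?_⟩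
  · rw [hstar, eR, hloop]; exact h1
  · rw [hstar, eR, hloop]
    dsimp only
    set acc := (((fun x : (ℕ × List ℤ) × ℤ => ((redL (((a, b), prec), x.1)).1, x.2 + (redL (((a, b), prec), x.1)).2))^[(s i - k).toNat] (cd k, (redL (((a, b), prec), latProd ((a, b), (cd (s i₁), cd (s i₂))))).2)).2 : ℤ)
    have e : (acc : ℝ) - 2 ^ prec * (Real.log (σ₁ (voronoiChain σ₁ σ₂ (1 : FractionalIdeal (𝓞 K)⁰ K) (1 : K) (s i))) - Real.log (σ₁ (voronoiChain σ₁ σ₂ (1 : FractionalIdeal (𝓞 K)⁰ K) (1 : K) (s i₁))) - Real.log (σ₁ (voronoiChain σ₁ σ₂ (1 : FractionalIdeal (𝓞 K)⁰ K) (1 : K) (s i₂)))) =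
        ((acc : ℝ) - ((redL (((a, b), prec), latProd ((a, b), (cd (s i₁), cd (s i₂))))).2 : ℝ) -
          2 ^ prec * (Real.log (σ₁ (voronoiChain σ₁ σ₂ (1 : FractionalIdeal (𝓞 K)⁰ K) (1 : K) (s i))) - Real.log (σ₁ (voronoiChain σ₁ σ₂ (1 : FractionalIdeal (𝓞 K)⁰ K) (1 : K) k)))) +
        (((redL (((a, b), prec), latProd ((a, b), (cd (s i₁), cd (s i₂))))).2 : ℝ) - 2 ^ prec * Real.log (σ₁ γ)) := by
      rw [hlogγ]; ring
    rw [e]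
    have hm5' : (((s i - k).toNat : ℕ) : ℝ) ≤ 5 := by exact_mod_cast hm5
    exact (abs_add_le _ _).trans (by linarith [h2, hlogR])
  · have h := log_voronoiChain_add_natCast_le hdeg hσ₂ ε hε hone k (s i - k).toNat
    rw [hm] at h
    have hm5' : (((s i - k).toNat : ℕ) : ℝ) ≤ 5 := by exact_mod_cast hm5
    have hL : 0 ≤ Real.log (3 * Real.sqrt |(discr K : ℝ)|) := by
      refine Real.log_nonneg ?_
      have h1 : (1 : ℝ) ≤ Real.sqrt |(discr K : ℝ)| := by
        rw [Real.one_le_sqrt, ← Int.cast_abs]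
        exact_mod_cast Int.one_le_abs (discr_ne_zero K)
      linarith
    nlinarith

include hdeg hσ₂ ε hε hab hab1 hθ in
/-- **Label sizes.** A canonical code `c` of a reduced ideal `ν(i)⁻¹𝓞_K` along the chain has denominator dividing
`3|N(ν(i))| ≤ 6√|d_K|/π` (`den_dvd_three_mul_natAbs_norm` with Dedekind's `3𝓞_K ⊆ ℤ⟨1, θ, θ₂⟩`,
`three_mul_natAbs_norm_le`) and entries in `[0, den]` (`entries_le_den`: `𝓞_K ⊆ ν(i)⁻¹𝓞_K` contains `1, θ, θ₂`);
so, given `6√|d_K|/π ≤ 243a²b²`, both are at most `243a²b²`. -/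
theorem chainLabel_bounds (hbd : 6 * Real.sqrt |(discr K : ℝ)| / Real.pi ≤ 243 * (a : ℝ) ^ 2 * (b : ℝ) ^ 2)
    {c : ℕ × List ℤ} (hc : Canon c) (i : ℤ)
    (hcJ : ∀ φ : K, Mem θ b c φ ↔ φ ∈ FractionalIdeal.spanSingleton (𝓞 K)⁰ (voronoiChain σ₁ σ₂ (1 : FractionalIdeal (𝓞 K)⁰ K) (1 : K) i)⁻¹ * (1 : FractionalIdeal (𝓞 K)⁰ K)) :
    c.1 ≤ 243 * a ^ 2 * b ^ 2 ∧ ∀ h ∈ c.2, 0 ≤ h ∧ h ≤ 243 * (a : ℤ) ^ 2 * (b : ℤ) ^ 2 := by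
  have hone := one_mem_posRelMinima_one (σ₁ := σ₁) hdeg hσ₂
  have hν := voronoiChain_mem hdeg hσ₂ ε hε hone i
  have hind : ∀ c₀ c₁ c₂ : ℚ, (c₀ : K) + (c₁ : K) * θ + (c₂ : K) * (θ ^ 2 / (b : K)) = 0 → c₀ = 0 ∧ c₁ = 0 ∧ c₂ = 0 :=
    fun _ _ _ h => coords_eq_zero hdeg hab hab1 hθ h
  obtain ⟨x, hx⟩ := (FractionalIdeal.mem_one_iff (𝓞 K)⁰).mp hν.1.1
  have hx0 : x ≠ 0 := by
    rintro rfl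
    exact hν.1.2.1 (by rw [← hx, map_zero])
  have hden : c.1 ∣ 3 * (Algebra.norm ℤ x).natAbs :=
    den_dvd_three_mul_natAbs_norm θ b hind (three_mul_mem_order hdeg hab hab1 hθ) hc hx0
      (fun φ hφ => by rw [hx]; exact (hcJ φ).1 hφ)
  have hnorm := three_mul_natAbs_norm_le hdeg hσ₂ (x := x) (by rw [hx]; exact hν.1)
  have hN0 : 0 < 3 * (Algebra.norm ℤ x).natAbs := by
    have : (Algebra.norm ℤ x).natAbs ≠ 0 := by
      rw [Ne, Int.natAbs_eq_zero]; exact Algebra.norm_ne_zero_iff.mpr hx0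
    omega
  have hdenle : c.1 ≤ 243 * a ^ 2 * b ^ 2 := by
    have h1 : c.1 ≤ 3 * (Algebra.norm ℤ x).natAbs := Nat.le_of_dvd hN0 hden
    have h2 : (((3 * (Algebra.norm ℤ x).natAbs : ℕ)) : ℝ) ≤ ((243 * a ^ 2 * b ^ 2 : ℕ) : ℝ) := by
      push_cast at hnorm ⊢
      linarith
    exact h1.trans (by exact_mod_cast h2)
  obtain ⟨hOle, -, -⟩ := reducedIdeal_bounds hdeg hσ₂ (one_mem_posRelMinima_inv_mul hν)
  have hmemO : ∀ φ : K, IsIntegral ℤ φ → Mem θ b c φ := fun φ hφ =>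
    (hcJ φ).2 (hOle ((mem_one_iff_isIntegral φ).mpr hφ))
  have hent := entries_le_den θ b hind hc (hmemO 1 isIntegral_one) (hmemO θ (isIntegral_theta hθ))
    (hmemO _ (isIntegral_theta₂ hab hθ))
  refine ⟨hdenle, fun h hh => ⟨(hent h hh).1, (hent h hh).2.trans ?_⟩⟩
  have : ((c.1 : ℕ) : ℤ) ≤ ((243 * a ^ 2 * b ^ 2 : ℕ) : ℤ) := by exact_mod_cast hdenle
  push_cast at this
  exact this

end Loops

/-! ### Closed form: the walk facts of the three programs -/

/-- **The walk facts of the cubic programs** (closed form, consumed by `GiantStepCycle.exists_of_chain`): with the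
codes `cd i` of the reduced ideals `ν(i)⁻¹𝓞_K` along Voronoi's chain, the enumeration `s` of the big-gap indices
(normalised at `0`, six-step spacing, period `(nS, n₀)`) and `|d_K| ≤ 2^prec`: `unitS = cd (s 0)`; the filtered baby
step moves `cd (s i) ↦ cd (s (i+1))` with log error `≤ 16`; the filtered giant step lands at some `cd (s i)` with raw
defect evaluator `starS.2 + unitS.2` within `16` of `2^prec ×` the true defect
`ℓ(s i) − ℓ(s i₁) − ℓ(s i₂) + ℓ(s 0)`, itself at most `11 log (3√|d_K|)` in absolute value. -/
theorem cubicWalk_facts : ∀ (a b : ℕ), Squarefree (a * b) → a * b ≠ 1 →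
    ∀ (K : Type) [Field K] [NumberField K], Module.finrank ℚ K = 3 → ∀ θ : K, θ ^ 3 = ((a * b ^ 2 : ℕ) : K) →
    ∀ (σ₁ : K →+* ℝ) (σ₂ : K →+* ℂ), (∃ z : K, starRingEnd ℂ (σ₂ z) ≠ σ₂ z) →
    ∀ (ε : (𝓞 K)ˣ), 1 < σ₁ (algebraMap (𝓞 K) K ε) →
    ∀ (lexE : (ℕ × ℕ) × (ℕ × List ℤ) → ℤ × ℤ × ℤ × ℕ) (logE : (ℕ × ℕ) × ((ℤ × ℤ × ℤ × ℕ) × ℕ) → ℤ)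
      (invE : (ℕ × ℕ) × (ℤ × ℤ × ℤ × ℕ) → ℤ × ℤ × ℤ × ℕ)
      (latScale : (ℕ × ℕ) × ((ℕ × List ℤ) × (ℤ × ℤ × ℤ × ℕ)) → ℕ × List ℤ)
      (latProd : (ℕ × ℕ) × ((ℕ × List ℤ) × (ℕ × List ℤ)) → ℕ × List ℤ) (ordL : ℕ × ℕ → ℕ × List ℤ)
      (redL : ((ℕ × ℕ) × ℕ) × (ℕ × List ℤ) → (ℕ × List ℤ) × ℤ) (isBigL : (ℕ × ℕ) × (ℕ × List ℤ) → Bool)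
      (rhoS : ((ℕ × ℕ) × ℕ) × (ℕ × List ℤ) → (ℕ × List ℤ) × ℤ)
      (starS : ((ℕ × ℕ) × ℕ) × ((ℕ × List ℤ) × (ℕ × List ℤ)) → (ℕ × List ℤ) × ℤ)
      (unitS : (ℕ × ℕ) × ℕ → (ℕ × List ℤ) × ℤ),
    CubicClassTable.LexMinSpec a b K θ σ₁ σ₂ lexE → CubicClassTable.LogSpec a b logE →
    CubicClassTable.InvSpec a b K θ invE → CubicClassTable.ScaleSpec a b K θ latScale →
    CubicClassTable.ProdSpec a b K θ latProd → CubicClassTable.OrdSpec a b K θ ordL →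
    CubicClassTable.RedLEq a b K θ lexE logE invE latScale redL → CubicClassTable.IsBigEq a b K θ lexE isBigL →
    CubicClassTable.RhoSEq redL isBigL rhoS → CubicClassTable.StarSEq redL isBigL latProd starS →
    CubicClassTable.UnitSEq redL isBigL ordL unitS →
    ∀ (cd : ℤ → ℕ × List ℤ), (∀ i : ℤ, PureCubicCodes.Canon (cd i) ∧ ∀ φ : K, PureCubicCodes.Mem θ b (cd i) φ ↔
      φ ∈ FractionalIdeal.spanSingleton (𝓞 K)⁰ (voronoiChain σ₁ σ₂ (1 : FractionalIdeal (𝓞 K)⁰ K) (1 : K) i)⁻¹ *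
        (1 : FractionalIdeal (𝓞 K)⁰ K)) →
    ∀ (s : ℤ → ℤ) (n₀ nS : ℕ), StrictMono s →
    (∀ i, 11 * σ₁ (voronoiChain σ₁ σ₂ (1 : FractionalIdeal (𝓞 K)⁰ K) (1 : K) (s i)) ≤
      10 * σ₁ (voronoiChain σ₁ σ₂ (1 : FractionalIdeal (𝓞 K)⁰ K) (1 : K) (s i + 1))) →
    (∀ j, 11 * σ₁ (voronoiChain σ₁ σ₂ (1 : FractionalIdeal (𝓞 K)⁰ K) (1 : K) j) ≤
      10 * σ₁ (voronoiChain σ₁ σ₂ (1 : FractionalIdeal (𝓞 K)⁰ K) (1 : K) (j + 1)) → ∃ i, s i = j) →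
    0 ≤ s 0 → (∀ j, 0 ≤ j → 11 * σ₁ (voronoiChain σ₁ σ₂ (1 : FractionalIdeal (𝓞 K)⁰ K) (1 : K) j) ≤
      10 * σ₁ (voronoiChain σ₁ σ₂ (1 : FractionalIdeal (𝓞 K)⁰ K) (1 : K) (j + 1)) → s 0 ≤ j) →
    (∀ i, s (i + 1) ≤ s i + 6) → 0 < n₀ → (∀ i, s (i + nS) = s i + n₀) →
    ∀ prec : ℕ, |(NumberField.discr K : ℝ)| ≤ 2 ^ prec →
    (unitS ((a, b), prec)).1 = cd (s 0) ∧
    (∀ i : ℤ, (rhoS (((a, b), prec), cd (s i))).1 = cd (s (i + 1))) ∧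
    (∀ i : ℤ, |((rhoS (((a, b), prec), cd (s i))).2 : ℝ) -
      2 ^ prec * (Real.log (σ₁ (voronoiChain σ₁ σ₂ (1 : FractionalIdeal (𝓞 K)⁰ K) (1 : K) (s (i + 1)))) -
        Real.log (σ₁ (voronoiChain σ₁ σ₂ (1 : FractionalIdeal (𝓞 K)⁰ K) (1 : K) (s i))))| ≤ 16) ∧
    (∀ i₁ i₂ : ℤ, ∃ i : ℤ, (starS (((a, b), prec), (cd (s i₁), cd (s i₂)))).1 = cd (s i) ∧
      |((((starS (((a, b), prec), (cd (s i₁), cd (s i₂)))).2 + (unitS ((a, b), prec)).2 : ℤ)) : ℝ) -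
        2 ^ prec * (Real.log (σ₁ (voronoiChain σ₁ σ₂ (1 : FractionalIdeal (𝓞 K)⁰ K) (1 : K) (s i))) -
          Real.log (σ₁ (voronoiChain σ₁ σ₂ (1 : FractionalIdeal (𝓞 K)⁰ K) (1 : K) (s i₁))) -
          Real.log (σ₁ (voronoiChain σ₁ σ₂ (1 : FractionalIdeal (𝓞 K)⁰ K) (1 : K) (s i₂))) +
          Real.log (σ₁ (voronoiChain σ₁ σ₂ (1 : FractionalIdeal (𝓞 K)⁰ K) (1 : K) (s 0))))| ≤ 16 ∧
      |Real.log (σ₁ (voronoiChain σ₁ σ₂ (1 : FractionalIdeal (𝓞 K)⁰ K) (1 : K) (s i))) -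
          Real.log (σ₁ (voronoiChain σ₁ σ₂ (1 : FractionalIdeal (𝓞 K)⁰ K) (1 : K) (s i₁))) -
          Real.log (σ₁ (voronoiChain σ₁ σ₂ (1 : FractionalIdeal (𝓞 K)⁰ K) (1 : K) (s i₂))) +
          Real.log (σ₁ (voronoiChain σ₁ σ₂ (1 : FractionalIdeal (𝓞 K)⁰ K) (1 : K) (s 0)))| ≤
        11 * Real.log (3 * Real.sqrt |(NumberField.discr K : ℝ)|)) := by
  intro a b hab hab1 K _ _ hdeg θ hθ σ₁ σ₂ hσ₂ ε hε lexE logE invE latScale latProd ordL redL isBigL rhoS starS unitS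
    hlex hlog hinv hscale hprod hord hred hbig hrho hstar hunit cd hcd s n₀ nS hsm hbigS hsurj hs0 hs0min h6 hn₀ hsper
    prec hdp
  have hone := one_mem_posRelMinima_one (σ₁ := σ₁) hdeg hσ₂
  obtain ⟨hu1, hu2⟩ := unitS_chain hdeg hσ₂ ε hε hab hab1 hθ hlex hlog hinv hscale hred hbig cd hcd prec hsm hbigS h6
    hord hunit hs0 hs0min
  -- `0 ≤ ℓ(s 0) ≤ 5 log (3√|d|)` (`ℓ 0 = 0`, `s 0 ≤ 5`)
  obtain ⟨hk5, -, -, hk⟩ := sZero_window hsm (fun j => 11 * σ₁ (voronoiChain σ₁ σ₂ (1 : FractionalIdeal (𝓞 K)⁰ K)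
    (1 : K) j) ≤ 10 * σ₁ (voronoiChain σ₁ σ₂ (1 : FractionalIdeal (𝓞 K)⁰ K) (1 : K) (j + 1))) hbigS h6 hs0 hs0min
  have hL : 0 ≤ Real.log (3 * Real.sqrt |(discr K : ℝ)|) := by
    refine Real.log_nonneg ?_
    have h1 : (1 : ℝ) ≤ Real.sqrt |(discr K : ℝ)| := by
      rw [Real.one_le_sqrt, ← Int.cast_abs]
      exact_mod_cast Int.one_le_abs (discr_ne_zero K)
    linarith
  have hℓ0 : Real.log (σ₁ (voronoiChain σ₁ σ₂ (1 : FractionalIdeal (𝓞 K)⁰ K) (1 : K) 0)) = 0 := by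
    rw [voronoiChain_zero, map_one, Real.log_one]
  have hC0 : 0 ≤ Real.log (σ₁ (voronoiChain σ₁ σ₂ (1 : FractionalIdeal (𝓞 K)⁰ K) (1 : K) (s 0))) := by
    have h := log_voronoiChain_le_of_le hdeg hσ₂ ε hε hone hs0
    rwa [hℓ0] at h
  have hC5 : Real.log (σ₁ (voronoiChain σ₁ σ₂ (1 : FractionalIdeal (𝓞 K)⁰ K) (1 : K) (s 0))) ≤
      5 * Real.log (3 * Real.sqrt |(discr K : ℝ)|) := by
    have h := log_voronoiChain_add_natCast_le hdeg hσ₂ ε hε hone 0 (s 0).toNat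
    rw [hk, hℓ0, zero_add] at h
    have hk5' : (((s 0).toNat : ℕ) : ℝ) ≤ 5 := by exact_mod_cast hk5
    nlinarith
  -- `log |d| ≤ 2 log (3√|d|)`
  have hd : 0 < |(discr K : ℝ)| := by rw [← Int.cast_abs]; exact_mod_cast abs_pos.mpr (discr_ne_zero K)
  have hlogd : Real.log |(discr K : ℝ)| ≤ 2 * Real.log (3 * Real.sqrt |(discr K : ℝ)|) := by
    rw [Real.log_mul (by norm_num) (Real.sqrt_pos.mpr hd).ne', Real.log_sqrt hd.le]
    have h3 : 0 ≤ Real.log 3 := Real.log_nonneg (by norm_num)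
    linarith
  refine ⟨hu1, fun i => (rhoS_chain hdeg hσ₂ ε hε hab hab1 hθ hlex hlog hinv hscale hred hbig cd hcd prec hsm hbigS
    hsurj h6 hrho i).1, fun i => (rhoS_chain hdeg hσ₂ ε hε hab hab1 hθ hlex hlog hinv hscale hred hbig cd hcd prec hsm
    hbigS hsurj h6 hrho i).2.trans (by norm_num), fun i₁ i₂ => ?_⟩
  obtain ⟨i, k, hst1, hst2, hA1, hA2, hB1, hB2⟩ := starS_chain hdeg hσ₂ ε hε hab hab1 hθ hlex hlog hinv hscale hred hbig
    cd hcd prec hsm hbigS hsurj h6 hprod hstar hn₀ hsper hdp i₁ i₂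
  refine ⟨i, hst1, ?_, ?_⟩
  · push_cast
    have e : ((starS (((a, b), prec), (cd (s i₁), cd (s i₂)))).2 : ℝ) + ((unitS ((a, b), prec)).2 : ℝ) -
        2 ^ prec * (Real.log (σ₁ (voronoiChain σ₁ σ₂ (1 : FractionalIdeal (𝓞 K)⁰ K) (1 : K) (s i))) -
          Real.log (σ₁ (voronoiChain σ₁ σ₂ (1 : FractionalIdeal (𝓞 K)⁰ K) (1 : K) (s i₁))) -
          Real.log (σ₁ (voronoiChain σ₁ σ₂ (1 : FractionalIdeal (𝓞 K)⁰ K) (1 : K) (s i₂))) +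
          Real.log (σ₁ (voronoiChain σ₁ σ₂ (1 : FractionalIdeal (𝓞 K)⁰ K) (1 : K) (s 0)))) =
      (((starS (((a, b), prec), (cd (s i₁), cd (s i₂)))).2 : ℝ) -
        2 ^ prec * (Real.log (σ₁ (voronoiChain σ₁ σ₂ (1 : FractionalIdeal (𝓞 K)⁰ K) (1 : K) (s i))) -
          Real.log (σ₁ (voronoiChain σ₁ σ₂ (1 : FractionalIdeal (𝓞 K)⁰ K) (1 : K) (s i₁))) -
          Real.log (σ₁ (voronoiChain σ₁ σ₂ (1 : FractionalIdeal (𝓞 K)⁰ K) (1 : K) (s i₂))))) +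
      (((unitS ((a, b), prec)).2 : ℝ) -
        2 ^ prec * Real.log (σ₁ (voronoiChain σ₁ σ₂ (1 : FractionalIdeal (𝓞 K)⁰ K) (1 : K) (s 0)))) := by ring
    rw [e]
    exact (abs_add_le _ _).trans (by linarith [hst2, hu2])
  · rw [abs_le]
    constructor <;> nlinarith [hA1, hA2, hB1, hB2, hC0, hC5, hlogd, hL]

end Summit.QuantumAdvantage.QuantumAdvantage.Theorems.LinnikCubicClassGroups
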